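import Summits.QuantumFields.BalabanUV.T4Continuum.Support.CovariantSliceComplement
import Summits.QuantumFields.BalabanUV.T4Continuum.Support.VariationalVectorRegularityRho

/-!
# T⁴ programme, spine node NE2 (U1a), lane P2 — leaf V-REG WITH BACKGROUND, file 3/3: THE `hREG k` BINDER OF THE VECTOR END FOR BAŁABAN's COVARIANT
# PROJECTED GAUGE FUNCTIONAL `projG R (ker Q_{T′})` WITH BACKGROUND — the matrix `GmProj R K` (PSD, `projG = qform GmProj ∘ unc`: the END's `hGm`∕`hG`
# binders for `projG` at ANY transports), its gauge-form gradient defect `defG = D_R(div_R − Π_S div_R)`, (REG-G) DISCHARGED by file 2's `nsqV_cDv_orthDiv_le`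
# (`cG = 0`, `cG′ = C₁²`, `C₁ = 4d·36^d(1 + n·w)²`), and `hREG_projG := hREG_rhoV` with ONLY V-UB ∕ V-P ∕ (Går) displayed (model level, `E = ℂ`)

NE2 formalisation swarm `b2b-balaban-t4-ne2-formalise-*`, leaf prover 03 GEN 6 (`prover-b2b-balaban-t4-ne2-formalise-leaf-03-g6-0`); journal INTENT
CLAIMS.log 2026-08-20 16:20Z «V-REG WITH BACKGROUND».  On top of files 1–2 (`CovariantBlockReversePoincare`, `CovariantSliceComplement`), gen 5's
`VariationalVectorRegularityRho.{defG, hREG_rhoV}` (p222597) and `VariationalVectorRegularity.{eq_of_forall_star_dotProduct, ipv_eq_sum,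
sum_ipv_eq_star_dotProduct}` (p222456), leaf-10-g3's `VariationalVectorLandauTower.{divM, divM_mulVec}` (p220989), leaf-09-g7's
`VariationalVectorGaugeSlice.{sliceSub, projG, avgOp}` (p221888), leaf-09-g6's `VariationalVectorGarding.{garding_of_poincare, qWV_le_line_of_divControl}`
(p219068) and leaf-01-g5's `VariationalVectorPoincare.qWV_le_line_poincare` — BY NAME.

THE STATEMENTS (model level; `E = ℂ`; transports `R`, `T`, `T′` DATA, c5).
 * §1 the slice projection as a matrix `projM R K` (`projM_mulVec : projM *ᵥ v = Π_{S_R(K)} v` read through `toLp`∕`ofLp`; `projMᴴ·projM` acts as `projM` —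
   self-adjoint idempotent), `divM_conjTranspose_mulVec : divMᴴ *ᵥ g = unc (D_R g)`, **`GmProj R K := (projM·divM)ᴴ·(projM·divM)`** — `GmProj_posSemidef`,
   **`projG_eq_qform : projG R K W = qform (GmProj R K) (unc W)`** (the END's `hGm`∕`hG` binders for Bałaban's functional WITH BACKGROUND, any `R`, `K`),
   `GmProj_mulVec_unc : GmProj *ᵥ unc W = unc (D_R (Π_S div_R W))`;
 * §2 **`defG_proj`**: gen 5's gauge-form gradient defect for `GmProj` IS `D_R(div_R W − Π_S div_R W)`; **`hRG_proj`**: (REG-G) for `K = ker Q_{T′}` (unitary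
   `T′`, `R`; in-block mismatch class `w`) with `cG = 0`, `cG′ = revPC²` — NO curvature hypothesis;
 * §3 **`hREG_projG`** — LEAF V-REG WITH BACKGROUND: for every datum `φ` and every minimiser `W` of `ScV n M R (projG R (ker Q_{T′}))` on `{QvL T · = φ}`,
   `rhoV n M R W ≤ C_R·(ScV W + nsqV φ)`, `C_R = 8Λ + 2d(n²p)(CGar + CGar′) + (8·revPC² + 5d²(n²p)²)·C_P`, displayed V-UB (`Λ`), V-P (`C_P`), (Går) (`CGar`, `CGar′`);
 * §4 **`hREG_projG_line_of_divControl`** — on the road's product-line transports `QvL (lineT T′ R)` (in-block defect class `2d(nw)² ≤ ½`, plaquette class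
   `40d(n²p) ≤ 1`): (Går) and V-P are leaf-09-g6's consequences of ONE displayed coercivity binder (GF3) `hGdiv : n^{−d}(n²·divSq_R W) ≤ C_D·ScV W + C_D′·nsqV (Q W)`
   (= the covariant (1.90), OPEN with background — (1.90) at `U = 1`), so V-REG WITH BACKGROUND displays only V-UB + (GF3).

HONEST FRAMING (T4-DAG p. 1).  Rung (B)+1 only — NOT infinite volume, NOT a mass gap, NOT Clay.  NE2 is NOT IN PRINT and NOT proved here.  MODEL LEVEL,
`E = ℂ`: transports ∕ `K` DATA, no identification with Bałaban's `U(Γ)`, `R_k(U)` ([B9] (3.21)–(3.27)) — c5.  What is proved is OURS and elementary ([folklore]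
linear algebra + files 1–2); nothing printed is a hypothesis; data `def`s `projLin`, `projM`, `GmProj` only; no `def … : Prop`; no `sorry`; axioms standard.
V-UB, V-P∕(Går) (= (GF3), the covariant (1.90)) and (SLICE-min)∕(ONE-min) with background stay DISPLAYED∕OPEN; V-END ∕ NE2 NOT proved; NE3 OPEN; spine PROVED 0∕9.
HONEST DEPENDENCY (cell, verbatim): continuum YM on T⁴ ⇐ BetaPertH ∧ nine spine estimates (0/9 proved); BetaPertH ⇐ (D1) ∧ (D4) ∧ CAP+tail; G-an2-4
gates asym, D1 and NE2/3/4.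
-/

noncomputable section

open scoped BigOperators ComplexConjugate ComplexOrder Matrix InnerProductSpace

namespace Summit.QuantumFields.BalabanUV.T4Continuum.VariationalVectorRegularityCovariant

open Finset WithLp
open Literature.Analysis.Complex (qform)
open Literature.MathematicalPhysics.QuantumFieldTheory.Balaban1983to89.B5Prop11Plancherel (Tor fine unitVec)
open Literature.MathematicalPhysics.QuantumFieldTheory.Balaban1983to89.B5Prop11Lower (nsq star_dotProduct_self)
open Literature.MathematicalPhysics.QuantumFieldTheory.Balaban1983to89.B5Blocks16 (blockOf)
open Summit.QuantumFields.BalabanUV.T4Continuum.BalabanAveragedCoerciveFibre (star_dotProduct_conjTranspose_mulVec)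
open Summit.QuantumFields.BalabanUV.T4Continuum.VariationalColourFederbush (cDv norm_le_one_of_mem_unitary)
open Summit.QuantumFields.BalabanUV.T4Continuum.VariationalColourBochner (ipv Dirv DirAdjv)
open Summit.QuantumFields.BalabanUV.T4Continuum.VariationalVectorBochner (gradDivV ipv_sum_left ipv_Dirv_right)
open Summit.QuantumFields.BalabanUV.T4Continuum.VariationalVectorWeitzenbock (divV divSq)
open Summit.QuantumFields.BalabanUV.T4Continuum.VariationalVectorFederbush (lineT norm_lineT_le_one)
open Summit.QuantumFields.BalabanUV.T4Continuum.VariationalVectorPoincare (qWV_le_line_poincare)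
open Summit.QuantumFields.BalabanUV.T4Continuum.VariationalVectorGarding (garding_of_poincare)
open Summit.QuantumFields.BalabanUV.T4Continuum.VectorBlockTrialForm (nsqV nsqV_nonneg QvL roughV)
open Summit.QuantumFields.BalabanUV.T4Continuum.VariationalVectorForm (ScV qWV ScV_nonneg)
open Summit.QuantumFields.BalabanUV.T4Continuum.VariationalVectorEffective (unc cur cur_unc unc_cur)
open Summit.QuantumFields.BalabanUV.T4Continuum.VariationalVectorOneStepPhys (rhoV)
open Summit.QuantumFields.BalabanUV.T4Continuum.VariationalVectorLandauTower (divM divM_mulVec)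
open Summit.QuantumFields.BalabanUV.T4Continuum.VariationalVectorRegularity (eq_of_forall_star_dotProduct ipv_eq_sum sum_ipv_eq_star_dotProduct)
open Summit.QuantumFields.BalabanUV.T4Continuum.VariationalVectorRegularityRho (defG hREG_rhoV)
open Summit.QuantumFields.BalabanUV.T4Continuum.VariationalVectorGaugeSlice (avgOp sliceSub projG)
open Summit.QuantumFields.BalabanUV.T4Continuum.CovariantBlockReversePoincare (revPC revPC_nonneg)
open Summit.QuantumFields.BalabanUV.T4Continuum.CovariantSliceComplement (projDiv projG_eq_nsqv_projDiv nsqV_cDv_orthDiv_le divSq_le_projG_add)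

variable {d : ℕ}

/-! ## §1 The matrix of Bałaban's projected gauge functional at ANY transports: `GmProj R K = (P_S·divM)ᴴ(P_S·divM)` -/

section MatrixForm

variable (N : Fin d → ℕ) [∀ μ, NeZero (N μ)]

/-- the slice projection `Π_{S_R(K)}` as a ℂ-linear map on plain functions (through `toLp`∕`ofLp`). [folklore] -/
def projLin (R : Tor N → Fin d → (ℂ →L[ℂ] ℂ)) (K : Submodule ℂ (Tor N → ℂ)) : (Tor N → ℂ) →ₗ[ℂ] (Tor N → ℂ) :=
  (WithLp.linearEquiv 2 ℂ (Tor N → ℂ)).toLinearMap ∘ₗ ((sliceSub N R K).starProjection : _ →L[ℂ] _).toLinearMap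
    ∘ₗ (WithLp.linearEquiv 2 ℂ (Tor N → ℂ)).symm.toLinearMap

/-- `projLin R K v = ofLp (Π_S (toLp v))`. [folklore] -/
theorem projLin_apply (R : Tor N → Fin d → (ℂ →L[ℂ] ℂ)) (K : Submodule ℂ (Tor N → ℂ)) (v : Tor N → ℂ) :
    projLin N R K v = ofLp ((sliceSub N R K).starProjection (toLp 2 v)) := rfl

/-- the slice projection matrix. [folklore] -/
def projM (R : Tor N → Fin d → (ℂ →L[ℂ] ℂ)) (K : Submodule ℂ (Tor N → ℂ)) : Matrix (Tor N) (Tor N) ℂ := LinearMap.toMatrix' (projLin N R K)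

/-- `projM *ᵥ v = ofLp (Π_S (toLp v))`. [folklore] -/
theorem projM_mulVec (R : Tor N → Fin d → (ℂ →L[ℂ] ℂ)) (K : Submodule ℂ (Tor N → ℂ)) (v : Tor N → ℂ) :
    projM N R K *ᵥ v = ofLp ((sliceSub N R K).starProjection (toLp 2 v)) := by
  rw [projM, LinearMap.toMatrix'_mulVec]; rfl

/-- the `star`-dot product is the `ℓ²` inner product: `v† u = ⟪toLp v, toLp u⟫`. [folklore] -/
theorem star_dotProduct_eq_inner (v u : Tor N → ℂ) : star v ⬝ᵥ u = ⟪(toLp 2 v : PiLp 2 (fun _ : Tor N => ℂ)), toLp 2 u⟫_ℂ := by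
  rw [EuclideanSpace.inner_toLp_toLp, dotProduct_comm]

/-- `projMᴴ·projM` acts as `projM` (the projection is self-adjoint and idempotent). [folklore] -/
theorem projM_conjTranspose_mulVec_projM (R : Tor N → Fin d → (ℂ →L[ℂ] ℂ)) (K : Submodule ℂ (Tor N → ℂ)) (u : Tor N → ℂ) :
    (projM N R K)ᴴ *ᵥ (projM N R K *ᵥ u) = projM N R K *ᵥ u := by
  set S := sliceSub N R K
  refine eq_of_forall_star_dotProduct fun v => ?_
  rw [star_dotProduct_conjTranspose_mulVec, projM_mulVec, projM_mulVec, star_dotProduct_eq_inner, star_dotProduct_eq_inner, toLp_ofLp, toLp_ofLp,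
    Submodule.inner_starProjection_left_eq_right, Submodule.starProjection_eq_self_iff.mpr (Submodule.starProjection_apply_mem S _)]

/-- **the divergence matrix's adjoint acts as the covariant gradient**: `divMᴴ *ᵥ g = unc (D_R g)`. [folklore] -/
theorem divM_conjTranspose_mulVec (R : Tor N → Fin d → (ℂ →L[ℂ] ℂ)) (g : Tor N → ℂ) : (divM N R)ᴴ *ᵥ g = unc (cDv N R g) := by
  refine eq_of_forall_star_dotProduct fun v => ?_
  have hL : star v ⬝ᵥ ((divM N R)ᴴ *ᵥ g) = ipv N (divV N R (cur v)) g := by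
    rw [star_dotProduct_conjTranspose_mulVec, ipv_eq_sum, VariationalVectorRegularity.star_dotProduct_eq_sum]
    exact sum_congr rfl fun x _ => by rw [divM_mulVec]
  have hdiv : divV N R (cur v) = fun x => ∑ μ, DirAdjv N R μ (fun y => cur v y μ) x := rfl
  have hR : star v ⬝ᵥ unc (cDv N R g) = ∑ μ, ipv N (fun y => cur v y μ) (Dirv N R μ g) := by
    rw [← unc_cur v, sum_ipv_eq_star_dotProduct, unc_cur]; rfl
  rw [hL, hR, hdiv, ipv_sum_left]
  exact sum_congr rfl fun μ _ => (ipv_Dirv_right N R μ _ _).symm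

/-- **THE MATRIX OF BAŁABAN's PROJECTED GAUGE FUNCTIONAL** (any transports `R`, any `K`): `GmProj R K := (projM·divM)ᴴ·(projM·divM)`. [folklore] -/
def GmProj (R : Tor N → Fin d → (ℂ →L[ℂ] ℂ)) (K : Submodule ℂ (Tor N → ℂ)) : Matrix (Tor N × Fin d) (Tor N × Fin d) ℂ :=
  (projM N R K * divM N R)ᴴ * (projM N R K * divM N R)

/-- `GmProj` is positive semidefinite — the END's `hGm` binder for `projG` WITH BACKGROUND. [folklore] -/
theorem GmProj_posSemidef (R : Tor N → Fin d → (ℂ →L[ℂ] ℂ)) (K : Submodule ℂ (Tor N → ℂ)) : (GmProj N R K).PosSemidef :=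
  Matrix.posSemidef_conjTranspose_mul_self _

/-- `(projM·divM) *ᵥ w` is the slice component of the divergence of `cur w`. [folklore] -/
theorem projM_divM_mulVec (R : Tor N → Fin d → (ℂ →L[ℂ] ℂ)) (K : Submodule ℂ (Tor N → ℂ)) (w : Tor N × Fin d → ℂ) :
    (projM N R K * divM N R) *ᵥ w = projDiv N R K (cur w) := by
  have h : divM N R *ᵥ w = divV N R (cur w) := funext fun x => divM_mulVec N R w x
  rw [← Matrix.mulVec_mulVec, h, projM_mulVec]
  rfl

/-- **`projG R K W = qform (GmProj R K) (unc W)`** — the END's `hG` binder for `projG` WITH BACKGROUND. [folklore] -/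
theorem projG_eq_qform (R : Tor N → Fin d → (ℂ →L[ℂ] ℂ)) (K : Submodule ℂ (Tor N → ℂ)) (W : Tor N → Fin d → ℂ) :
    projG N R K W = qform (GmProj N R K) (unc W) := by
  rw [qform, GmProj, ← Matrix.mulVec_mulVec, star_dotProduct_conjTranspose_mulVec, star_dotProduct_self, Complex.ofReal_re, projM_divM_mulVec, cur_unc,
    projG_eq_nsqv_projDiv]
  rfl

/-- **`GmProj *ᵥ unc W = unc (D_R (Π_S div_R W))`**. [folklore] -/
theorem GmProj_mulVec_unc (R : Tor N → Fin d → (ℂ →L[ℂ] ℂ)) (K : Submodule ℂ (Tor N → ℂ)) (W : Tor N → Fin d → ℂ) :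
    GmProj N R K *ᵥ unc W = unc (cDv N R (projDiv N R K W)) := by
  have h : divM N R *ᵥ unc W = divV N R W := by funext x; rw [divM_mulVec, cur_unc]
  rw [GmProj, ← Matrix.mulVec_mulVec, Matrix.conjTranspose_mul, ← Matrix.mulVec_mulVec, ← Matrix.mulVec_mulVec, h,
    projM_conjTranspose_mulVec_projM, divM_conjTranspose_mulVec, projM_mulVec]
  rfl

end MatrixForm

/-! ## §2 The gauge-form gradient defect of `GmProj` and (REG-G) WITH BACKGROUND -/

section Defect

variable (n : ℕ) [NeZero n] (M : Fin d → ℕ) [hM : ∀ μ, NeZero (M μ)]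

/-- **gen 5's gauge-form gradient defect for `GmProj` IS `D_R(div_R W − Π_S div_R W)`**. [folklore] -/
theorem defG_proj (R : Tor (fine n M) → Fin d → (ℂ →L[ℂ] ℂ)) (K : Submodule ℂ (Tor (fine n M) → ℂ)) (W : Tor (fine n M) → Fin d → ℂ) :
    defG n M R (GmProj (fine n M) R K) W = cDv (fine n M) R (divV (fine n M) R W - projDiv (fine n M) R K W) := by
  have hsub : cDv (fine n M) R (divV (fine n M) R W - projDiv (fine n M) R K W)
      = cDv (fine n M) R (divV (fine n M) R W) - cDv (fine n M) R (projDiv (fine n M) R K W) :=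
    (VariationalVectorGaugeSlice.gradOp (fine n M) R).map_sub _ _
  funext x ν
  rw [hsub, defG, GmProj_mulVec_unc, cur_unc]
  rfl

/-- **(REG-G) FOR BAŁABAN's PROJECTED GAUGE FUNCTIONAL WITH BACKGROUND** — `K = ker Q_{T′}`, unitary `T′` and `R`, in-block mismatch class `w`, NO curvature
hypothesis: `(n⁴/n^d)·nsqV (defG W) ≤ 0·ScV W + revPC²·qWV W`. [folklore] -/
theorem hRG_proj {T' : Tor (fine n M) → (ℂ →L[ℂ] ℂ)} (hT' : ∀ x, T' x ∈ unitary (ℂ →L[ℂ] ℂ))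
    {R : Tor (fine n M) → Fin d → (ℂ →L[ℂ] ℂ)} (hU : ∀ x μ, R x μ ∈ unitary (ℂ →L[ℂ] ℂ)) {w : ℝ} (hw0 : 0 ≤ w)
    (hw : ∀ (x : Tor (fine n M)) (μ : Fin d), blockOf n M (x + unitVec (fine n M) μ) = blockOf n M x →
      ‖R x μ * star (T' (x + unitVec (fine n M) μ)) * T' x - 1‖ ≤ w)
    (W : Tor (fine n M) → Fin d → ℂ) :
    (n : ℝ) ^ 4 / (n : ℝ) ^ d * nsqV (fine n M) (defG n M R (GmProj (fine n M) R (LinearMap.ker (avgOp n M T'))) W)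
      ≤ 0 * ScV n M R (projG (fine n M) R (LinearMap.ker (avgOp n M T'))) W + revPC d n w ^ 2 * qWV n M W := by
  have hn : (0 : ℝ) < (n : ℝ) := by exact_mod_cast Nat.pos_of_ne_zero (NeZero.ne n)
  have h := nsqV_cDv_orthDiv_le n M hT' hU hw0 hw W
  rw [defG_proj, zero_mul, zero_add, div_eq_mul_inv, mul_comm ((n : ℝ) ^ 4), mul_assoc]
  unfold qWV
  rw [← mul_assoc (revPC d n w ^ 2), mul_comm (revPC d n w ^ 2), mul_assoc]
  exact mul_le_mul_of_nonneg_left h (by positivity)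

/-- the divergence-control form of file 2's third consequence in the END's physical units: `n^{−d}(n²·divSq_R W) ≤ 1·ScV·(…)`-type bookkeeping —
`n^{−d}(n²·divSq_R W) ≤ n^{−d}(n²·projG W) + revPC·qWV W`. [folklore] -/
theorem phys_divSq_le {T' : Tor (fine n M) → (ℂ →L[ℂ] ℂ)} (hT' : ∀ x, T' x ∈ unitary (ℂ →L[ℂ] ℂ))
    {R : Tor (fine n M) → Fin d → (ℂ →L[ℂ] ℂ)} (hU : ∀ x μ, R x μ ∈ unitary (ℂ →L[ℂ] ℂ)) {w : ℝ} (hw0 : 0 ≤ w)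
    (hw : ∀ (x : Tor (fine n M)) (μ : Fin d), blockOf n M (x + unitVec (fine n M) μ) = blockOf n M x →
      ‖R x μ * star (T' (x + unitVec (fine n M) μ)) * T' x - 1‖ ≤ w)
    (W : Tor (fine n M) → Fin d → ℂ) :
    ((n : ℝ) ^ d)⁻¹ * ((n : ℝ) ^ 2 * divSq (fine n M) R W)
      ≤ ((n : ℝ) ^ d)⁻¹ * ((n : ℝ) ^ 2 * projG (fine n M) R (LinearMap.ker (avgOp n M T')) W) + revPC d n w * qWV n M W := by
  have h := divSq_le_projG_add n M hT' hU hw0 hw W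
  unfold qWV
  rw [← mul_assoc (revPC d n w), mul_comm (revPC d n w) (((n : ℝ) ^ d)⁻¹), mul_assoc, ← mul_add]
  exact mul_le_mul_of_nonneg_left h (by positivity)

end Defect

/-! ## §3 LEAF V-REG WITH BACKGROUND for `projG R (ker Q_{T′})`: displayed V-UB, V-P, (Går) -/

section Reg

variable (n : ℕ) [NeZero n] (M : Fin d → ℕ) [hM : ∀ μ, NeZero (M μ)]

/-- **LEAF V-REG WITH BACKGROUND — THE `hREG k` BINDER OF THE VECTOR END FOR BAŁABAN's COVARIANT PROJECTED GAUGE FUNCTIONAL** (model level, `E = ℂ`).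
DATA: unitary bond transports `R` with plaquette defect `≤ p`; unitary site transports `T′` (defining `K = ker Q_{T′}`) in the in-block mismatch class
`‖R(x,μ)∘T′(x+e_μ)⋆∘T′(x) − 1‖ ≤ w`; contractive line transports `T` of the (1.18) average.  DISPLAYED: V-UB `hUBc` (`Λ`), V-P `hPc` (`C_P`), (Går) `hGar`
(`CGar`, `CGar′`).  (REG-G) is DISCHARGED (`hRG_proj`).  CONCLUSION: for every datum `φ` and every minimiser `W` of `ScV n M R (projG R K)` on `{QvL T · = φ}`,
`rhoV n M R W ≤ (8Λ + 2d(n²p)(CGar + CGar′) + (8·revPC² + 5d²(n²p)²)·C_P)·(ScV W + nsqV φ)`. [folklore] -/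
theorem hREG_projG {R : Tor (fine n M) → Fin d → (ℂ →L[ℂ] ℂ)} (hU : ∀ x μ, R x μ ∈ unitary (ℂ →L[ℂ] ℂ)) {p : ℝ} (hp : 0 ≤ p)
    (hP : ∀ x μ ν, ‖R x μ * R (x + unitVec (fine n M) μ) ν - R x ν * R (x + unitVec (fine n M) ν) μ‖ ≤ p)
    {T' : Tor (fine n M) → (ℂ →L[ℂ] ℂ)} (hT' : ∀ x, T' x ∈ unitary (ℂ →L[ℂ] ℂ)) {w : ℝ} (hw0 : 0 ≤ w)
    (hw : ∀ (x : Tor (fine n M)) (μ : Fin d), blockOf n M (x + unitVec (fine n M) μ) = blockOf n M x →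
      ‖R x μ * star (T' (x + unitVec (fine n M) μ)) * T' x - 1‖ ≤ w)
    {T : Tor M → (Fin d → Fin n) → Fin n → Fin d → (ℂ →L[ℂ] ℂ)} (hT : ∀ y j t μ, ‖T y j t μ‖ ≤ 1)
    {Λ CP CGar CGar' : ℝ} (hΛ : 0 ≤ Λ) (hCGar : 0 ≤ CGar) (hCGar' : 0 ≤ CGar')
    (hUBc : ∀ φ : Tor M → Fin d → ℂ, ∃ W, QvL n M T W = φ ∧ ScV n M R (projG (fine n M) R (LinearMap.ker (avgOp n M T'))) W ≤ Λ * nsqV M φ)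
    (hPc : ∀ W, qWV n M W ≤ CP * (ScV n M R (projG (fine n M) R (LinearMap.ker (avgOp n M T'))) W + nsqV M (QvL n M T W)))
    (hGar : ∀ W, ((n : ℝ) ^ d)⁻¹ * ((n : ℝ) ^ 2 * roughV n M R W)
      ≤ CGar * ScV n M R (projG (fine n M) R (LinearMap.ker (avgOp n M T'))) W + CGar' * nsqV M (QvL n M T W)) :
    ∀ (φ : Tor M → Fin d → ℂ) (W : Tor (fine n M) → Fin d → ℂ), QvL n M T W = φ →
      (∀ W₂, QvL n M T W₂ = φ → ScV n M R (projG (fine n M) R (LinearMap.ker (avgOp n M T'))) W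
        ≤ ScV n M R (projG (fine n M) R (LinearMap.ker (avgOp n M T'))) W₂) →
      rhoV n M R W ≤ (8 * Λ + 2 * d * ((n : ℝ) ^ 2 * p) * (CGar + CGar') + (8 * revPC d n w ^ 2 + 5 * (d : ℝ) ^ 2 * ((n : ℝ) ^ 2 * p) ^ 2) * CP)
        * (ScV n M R (projG (fine n M) R (LinearMap.ker (avgOp n M T'))) W + nsqV M φ) := by
  intro φ W hW hmin
  set K := LinearMap.ker (avgOp n M T')
  have h := hREG_rhoV n M hU hp hP (GmProj_posSemidef (fine n M) R K) (projG_eq_qform (fine n M) R K) hT hΛ hCGar hCGar' le_rfl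
    (sq_nonneg (revPC d n w)) hUBc hPc hGar (hRG_proj n M hT' hU hw0 hw) φ W hW hmin
  have e : 8 * Λ + 8 * (0 : ℝ) + 2 * d * ((n : ℝ) ^ 2 * p) * (CGar + CGar') + (8 * revPC d n w ^ 2 + 5 * (d : ℝ) ^ 2 * ((n : ℝ) ^ 2 * p) ^ 2) * CP
      = 8 * Λ + 2 * d * ((n : ℝ) ^ 2 * p) * (CGar + CGar') + (8 * revPC d n w ^ 2 + 5 * (d : ℝ) ^ 2 * ((n : ℝ) ^ 2 * p) ^ 2) * CP := by ring
  rwa [e] at h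

/-! ## §4 The road's product-line transports: (Går) and V-P from ONE displayed coercivity binder (GF3) -/

/-- **LEAF V-REG WITH BACKGROUND ON THE ROAD's PRODUCT-LINE TRANSPORTS `QvL (lineT T′ R)`, MODULO V-UB AND (GF3)** (model level, `E = ℂ`): unitary `T′`,
`R`; in-block defect class `2d(nw)² ≤ ½`; plaquette class `40·d·(n²p) ≤ 1`; DISPLAYED: V-UB (`Λ`) and the coercivity binder (GF3)
`hGdiv : n^{−d}(n²·divSq_R W) ≤ C_D·ScV W + C_D′·nsqV (Q W)` (`0 ≤ C_D, C_D′`; the covariant (1.90) — OPEN with background; at `U = 1` it is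
leaf-09-g7's kernel fact).  (Går) and V-P are then leaf-09-g6's `garding_of_poincare` ∕ `qWV_le_line_of_divControl` over leaf-01-g5's rough Poincaré
`qWV_le_line_poincare` (A = 16, B = 20), and (REG-G) is `hRG_proj`:
`rhoV n M R W ≤ C_R·(ScV W + nsqV φ)` with `C_R = 8Λ + 2dα·(κ + κ′) + (8·revPC² + 5d²α²)·max(20κ, 16 + 20κ′)`, `α = n²p`, `κ = 2(1 + C_D)`,
`κ′ = 2(C_D′ + 16dα)`. [folklore] -/
theorem hREG_projG_line_of_divControl {R : Tor (fine n M) → Fin d → (ℂ →L[ℂ] ℂ)} (hU : ∀ x μ, R x μ ∈ unitary (ℂ →L[ℂ] ℂ))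
    {T' : Tor (fine n M) → (ℂ →L[ℂ] ℂ)} (hT' : ∀ x, T' x ∈ unitary (ℂ →L[ℂ] ℂ)) {w : ℝ} (hw0 : 0 ≤ w)
    (hw : ∀ (x : Tor (fine n M)) (μ : Fin d), blockOf n M (x + unitVec (fine n M) μ) = blockOf n M x →
      ‖R x μ * star (T' (x + unitVec (fine n M) μ)) * T' x - 1‖ ≤ w)
    (hsmallw : 2 * (d : ℝ) * ((n : ℝ) * w) ^ 2 ≤ 1 / 2) {p : ℝ} (hp : 0 ≤ p)
    (hP : ∀ x μ ν, ‖R x μ * R (x + unitVec (fine n M) μ) ν - R x ν * R (x + unitVec (fine n M) ν) μ‖ ≤ p)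
    (hsmallp : 40 * (d * ((n : ℝ) ^ 2 * p)) ≤ 1) {Λ CD CD' : ℝ} (hΛ : 0 ≤ Λ) (hCD : 0 ≤ CD) (hCD' : 0 ≤ CD')
    (hUBc : ∀ φ : Tor M → Fin d → ℂ, ∃ W, QvL n M (lineT n M T' R) W = φ ∧
      ScV n M R (projG (fine n M) R (LinearMap.ker (avgOp n M T'))) W ≤ Λ * nsqV M φ)
    (hGdiv : ∀ W, ((n : ℝ) ^ d)⁻¹ * ((n : ℝ) ^ 2 * divSq (fine n M) R W)
      ≤ CD * ScV n M R (projG (fine n M) R (LinearMap.ker (avgOp n M T'))) W + CD' * nsqV M (QvL n M (lineT n M T' R) W)) :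
    ∀ (φ : Tor M → Fin d → ℂ) (W : Tor (fine n M) → Fin d → ℂ), QvL n M (lineT n M T' R) W = φ →
      (∀ W₂, QvL n M (lineT n M T' R) W₂ = φ → ScV n M R (projG (fine n M) R (LinearMap.ker (avgOp n M T'))) W
        ≤ ScV n M R (projG (fine n M) R (LinearMap.ker (avgOp n M T'))) W₂) →
      rhoV n M R W ≤ (8 * Λ + 2 * d * ((n : ℝ) ^ 2 * p) * (2 * (1 + CD) + 2 * (CD' + d * ((n : ℝ) ^ 2 * p) * 16))
          + (8 * revPC d n w ^ 2 + 5 * (d : ℝ) ^ 2 * ((n : ℝ) ^ 2 * p) ^ 2)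
            * max (20 * (2 * (1 + CD))) (16 + 20 * (2 * (CD' + d * ((n : ℝ) ^ 2 * p) * 16))))
        * (ScV n M R (projG (fine n M) R (LinearMap.ker (avgOp n M T'))) W + nsqV M φ) := by
  intro φ W hW hmin
  set K := LinearMap.ker (avgOp n M T')
  have hR1 : ∀ x μ, ‖R x μ‖ ≤ 1 := fun x μ => norm_le_one_of_mem_unitary (hU x μ)
  have hT1 : ∀ x, ‖T' x‖ ≤ 1 := fun x => norm_le_one_of_mem_unitary (hT' x)
  have hT : ∀ y j t μ, ‖lineT n M T' R y j t μ‖ ≤ 1 := fun y j t μ => norm_lineT_le_one n M hR1 hT1 y j t μ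
  have hG0 : ∀ W, 0 ≤ projG (fine n M) R K W := fun W => VariationalVectorGaugeSlice.projG_nonneg (fine n M) R K W
  have hsmall : 2 * 20 * (d * ((n : ℝ) ^ 2 * p)) ≤ 1 := by linarith
  have hPoinc := qWV_le_line_poincare n M hT' hR1 hw hsmallw
  have hGar := fun W => garding_of_poincare n M hU hp hP hG0 hGdiv hPoinc hsmall W
  have hPc := fun W => VariationalVectorGarding.qWV_le_line_of_divControl n M hT' hU hw hsmallw hp hP hsmallp hG0 hGdiv W
  have hα : 0 ≤ d * ((n : ℝ) ^ 2 * p) := by positivity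
  have hCGar : (0 : ℝ) ≤ 2 * (1 + CD) := by positivity
  have hCGar' : (0 : ℝ) ≤ 2 * (CD' + d * ((n : ℝ) ^ 2 * p) * 16) := by positivity
  exact hREG_projG n M hU hp hP hT' hw0 hw hT hΛ hCGar hCGar' hUBc hPc hGar φ W hW hmin

end Reg

end Summit.QuantumFields.BalabanUV.T4Continuum.VariationalVectorRegularityCovariant

end
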